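import Literature.Computability.Complexity.PaulPippengerSzemerediTrotter1983Formats
import HarnessLib

/-!
# Token shapes: when the decoders of the `Σ₄` protocol succeed (PPST 1983, §3)

Literature / complexity toolkit, twenty-second brick of the inline formalization of
Paul–Pippenger–Szemerédi–Trotter 1983 (`PaulPippengerSzemerediTrotter1983.lean`, fact
`PaulEtAl1983_NTIME_not_subset_DTIME`; roadmap Layer 4, machines, part 3). The linear-time
verifier must decide, among other things, WHETHER the strings `y₁`, `y₃`, `y₄` decode
(`…Formats.lean`). Decodability is a regular property of the token stream: a field is "data bits
then an end-of-field", a record is "`9K + 2` fields then an end-of-record", and `y₁` decodes iff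
its tokens are "a field, then one or more records, exactly". This file isolates these SHAPE
functions — the one-counter automata the verifier will run — and proves that the decoders succeed
exactly when the shapes do:

* `skipField`, `skipFields`, `skipRec`, `countRecs` (records to the end, counted);
* `skipField_eq`, `groups_skip`, `recP_skip`, `recsP_count`;
* **`decY1_isSome_iff`**: `decY1 K y ≠ none ↔ ∃ ts, toks y = some ts ∧ ∃ ts₁, skipField ts = some ts₁ ∧
  ∃ c, countRecs (9K+2) ts₁.length ts₁ = some c ∧ 1 ≤ c`, and `recs_length_of_decY1`
  (the count is the number of records);
* `skipEntry`, `countEntries`, **`decY3_isSome_iff`**;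
* **`decJ_isSome_iff`**.

No named fact is introduced (definitions with bodies and theorems only).

## References

* W. J. Paul, N. Pippenger, E. Szemerédi, W. T. Trotter, *On determinism versus non-determinism
  and related problems*, FOCS 1983, 429–438, §3 [PaulEtAl1983].
-/

namespace Literature.Computability.Complexity

open Function

namespace PPSTSpec

/-! ### Skipping fields and records -/

/-- Skip one field: data bits up to and including the end-of-field token. [folklore] -/
def skipField : List Tok → Option (List Tok)
  | .bit _ :: ts => skipField ts
  | .sep :: ts => some ts
  | _ => none

/-- Skip `n` fields. [folklore] -/
def skipFields : ℕ → List Tok → Option (List Tok)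
  | 0, ts => some ts
  | n + 1, ts => (skipField ts).bind (skipFields n)

/-- Skip one record of `R` fields: the fields, then the end-of-record token. [folklore] -/
def skipRec (R : ℕ) (ts : List Tok) : Option (List Tok) :=
  (skipFields R ts).bind fun ts' =>
    match ts' with
    | .stop :: ts'' => some ts''
    | _ => none

/-- Count the records to the end of the stream (fuelled). [folklore] -/
def countRecs (R : ℕ) : ℕ → List Tok → Option ℕ
  | _, [] => some 0
  | 0, _ :: _ => none
  | f + 1, ts => (skipRec R ts).bind fun ts' => (countRecs R f ts').map (· + 1)

/-- `field` and `skipField` agree on the rest. [folklore] -/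
theorem skipField_eq (ts : List Tok) : skipField ts = (field ts).map Prod.snd := by
  induction ts with
  | nil => rfl
  | cons t ts ih =>
    cases t with
    | bit d =>
      simp only [skipField, field, ih]
      cases field ts <;> rfl
    | sep => rfl
    | stop => rfl

/-- `skipFields (a + b) = skipFields a` then `skipFields b`. [folklore] -/
theorem skipFields_add : ∀ (a b : ℕ) (ts : List Tok),
    skipFields (a + b) ts = (skipFields a ts).bind (skipFields b)
  | 0, b, ts => by simp [skipFields]
  | a + 1, b, ts => by
    rw [Nat.add_right_comm]
    simp only [skipFields]
    rcases skipField ts with _ | ts'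
    · rfl
    · exact skipFields_add a b ts'

/-- A group parser that skips `m` fields makes `groups p n` skip `n m` fields. [folklore] -/
theorem groups_skip {α : Type} {p : List Tok → Option (α × List Tok)} {m : ℕ}
    (hp : ∀ ts, (p ts).map Prod.snd = skipFields m ts) :
    ∀ (n : ℕ) (ts : List Tok), (groups p n ts).map Prod.snd = skipFields (n * m) ts
  | 0, ts => by simp [groups, skipFields]
  | n + 1, ts => by
    rw [Nat.succ_mul, show n * m + m = m + n * m from Nat.add_comm _ _, skipFields_add, ← hp ts]
    simp only [groups, Option.bind_eq_bind]
    rcases p ts with _ | ⟨a, ts'⟩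
    · rfl
    · simp only [Option.map_some, Option.bind_some]
      rw [← groups_skip hp n ts']
      rcases groups p n ts' with _ | ⟨as, ts''⟩ <;> rfl

/-- `numsP` skips seven fields. [folklore] -/
theorem numsP_skip (ts : List Tok) : (numsP ts).map Prod.snd = skipFields 7 ts := by
  simp only [numsP, skipFields, Option.bind_eq_bind, skipField_eq]
  rcases field ts with _ | ⟨w₁, t₁⟩
  · rfl
  simp only [Option.map_some, Option.bind_some]
  rcases field t₁ with _ | ⟨w₂, t₂⟩
  · rfl
  simp only [Option.map_some, Option.bind_some]
  rcases field t₂ with _ | ⟨w₃, t₃⟩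
  · rfl
  simp only [Option.map_some, Option.bind_some]
  rcases field t₃ with _ | ⟨w₄, t₄⟩
  · rfl
  simp only [Option.map_some, Option.bind_some]
  rcases field t₄ with _ | ⟨w₅, t₅⟩
  · rfl
  simp only [Option.map_some, Option.bind_some]
  rcases field t₅ with _ | ⟨w₆, t₆⟩
  · rfl
  simp only [Option.map_some, Option.bind_some]
  rcases field t₆ with _ | ⟨w₇, t₇⟩
  · rfl
  rfl

/-- `hvP` skips two fields. [folklore] -/
theorem hvP_skip (ts : List Tok) : (hvP ts).map Prod.snd = skipFields 2 ts := by
  simp only [hvP, skipFields, Option.bind_eq_bind, skipField_eq]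
  rcases field ts with _ | ⟨w₁, t₁⟩
  · rfl
  simp only [Option.map_some, Option.bind_some]
  rcases field t₁ with _ | ⟨w₂, t₂⟩
  · rfl
  rfl


/-- `egP` skips six fields. [folklore] -/
theorem egP_skip (ts : List Tok) : (egP ts).map Prod.snd = skipFields 6 ts := by
  simp only [egP, skipFields, Option.bind_eq_bind, skipField_eq]
  rcases field ts with _ | ⟨w₁, t₁⟩
  · rfl
  simp only [Option.map_some, Option.bind_some]
  rcases field t₁ with _ | ⟨w₂, t₂⟩
  · rfl
  simp only [Option.map_some, Option.bind_some]
  rcases field t₂ with _ | ⟨w₃, t₃⟩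
  · rfl
  simp only [Option.map_some, Option.bind_some]
  rcases field t₃ with _ | ⟨w₄, t₄⟩
  · rfl
  simp only [Option.map_some, Option.bind_some]
  rcases field t₄ with _ | ⟨w₅, t₅⟩
  · rfl
  simp only [Option.map_some, Option.bind_some]
  rcases field t₅ with _ | ⟨w₆, t₆⟩
  · rfl
  simp only [Option.map_some, Option.bind_some]

/-- **`recP` skips a record of `9K + 2` fields.** [folklore] -/
theorem recP_skip (K : ℕ) (ts : List Tok) : (recP K ts).map Prod.snd = skipRec (9 * K + 2) ts := by
  have e : 9 * K + 2 = 1 + (K * 7 + (1 + K * 2)) := by ring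
  unfold recP skipRec
  rw [e, skipFields_add]
  simp only [skipFields, Option.bind_eq_bind, skipField_eq]
  rcases field ts with _ | ⟨pcw, t₁⟩
  · rfl
  simp only [Option.map_some, Option.bind_some]
  rw [skipFields_add, ← groups_skip numsP_skip K t₁]
  rcases groups numsP K t₁ with _ | ⟨ns, t₂⟩
  · rfl
  simp only [Option.map_some, Option.bind_some]
  rw [skipFields_add]
  simp only [skipFields, skipField_eq]
  rcases field t₂ with _ | ⟨jb, t₃⟩
  · rfl
  simp only [Option.map_some, Option.bind_some]
  rw [← groups_skip hvP_skip K t₃]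
  rcases groups hvP K t₃ with _ | ⟨hs, t₄⟩
  · rfl
  simp only [Option.map_some, Option.bind_some]
  rcases t₄ with _ | ⟨_ | _ | _, t₅⟩ <;> rfl

/-- **`recsP` succeeds iff the records count to the end**, and then the count is the number of
records. [folklore] -/
theorem recsP_count (K : ℕ) : ∀ (f : ℕ) (ts : List Tok),
    (recsP K f ts).map List.length = countRecs (9 * K + 2) f ts
  | f, [] => by cases f <;> rfl
  | 0, _ :: _ => rfl
  | f + 1, t :: ts => by
    simp only [recsP, countRecs, Option.bind_eq_bind]
    rw [← recP_skip K (t :: ts)]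
    rcases recP K (t :: ts) with _ | ⟨r, ts'⟩
    · rfl
    · simp only [Option.map_some, Option.bind_some]
      rw [← recsP_count K f ts']
      rcases recsP K f ts' with _ | rs <;> rfl

/-- **Decodability of `y₁` is a shape property.** [folklore] -/
theorem decY1_isSome_iff (K : ℕ) (y : List Bool) :
    decY1 K y ≠ none ↔ ∃ ts, toks y = some ts ∧ ∃ ts₁, skipField ts = some ts₁ ∧
      ∃ c, countRecs (9 * K + 2) ts₁.length ts₁ = some c ∧ 1 ≤ c := by
  unfold decY1
  rcases htk : toks y with _ | ts
  · simp
  simp only [Option.bind_eq_bind, Option.bind_some, ne_eq, Option.some.injEq, exists_eq_left']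
  rw [skipField_eq]
  rcases hf : field ts with _ | ⟨bw, ts₁⟩
  · simp
  simp only [Option.bind_some, Option.map_some, Option.some.injEq, exists_eq_left']
  have hc := recsP_count K ts₁.length ts₁
  rcases hr : recsP K ts₁.length ts₁ with _ | rs
  · rw [hr] at hc; simp only [Option.map_none] at hc
    simp [← hc]
  · rw [hr] at hc; simp only [Option.map_some] at hc
    simp only [Option.bind_some, ← hc, Option.some.injEq, exists_eq_left']
    cases rs with
    | nil => simp
    | cons r rs => simp

/-- The number of records of a decoded `y₁` is the record count of its tokens. [folklore] -/
theorem recs_length_of_decY1 {K : ℕ} {y : List Bool} {D : Y1 K} (h : decY1 K y = some D) :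
    ∃ ts, toks y = some ts ∧ ∃ ts₁, skipField ts = some ts₁ ∧
      countRecs (9 * K + 2) ts₁.length ts₁ = some D.recs.length := by
  unfold decY1 at h
  rcases htk : toks y with _ | ts
  · rw [htk] at h; simp at h
  rw [htk] at h
  simp only [Option.bind_eq_bind, Option.bind_some] at h
  refine ⟨ts, rfl, ?_⟩
  rw [skipField_eq]
  rcases hf : field ts with _ | ⟨bw, ts₁⟩
  · rw [hf] at h; simp at h
  rw [hf] at h
  simp only [Option.bind_some] at h
  refine ⟨ts₁, rfl, ?_⟩
  rw [← recsP_count]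
  rcases hr : recsP K ts₁.length ts₁ with _ | rs
  · rw [hr] at h; simp at h
  rw [hr] at h
  simp only [Option.bind_some] at h
  split at h
  · simp at h
  · simp only [Option.some.injEq] at h
    subst h; rfl

/-! ### Entries -/

/-- Skip one entry: a field, `2K` fields, the end-of-record token. [folklore] -/
def skipEntry (K : ℕ) (ts : List Tok) : Option (List Tok) := skipRec (1 + 6 * K) ts

/-- Count the entries to the end of the stream (fuelled). [folklore] -/
def countEntries (K : ℕ) : ℕ → List Tok → Option ℕ
  | _, [] => some 0
  | 0, _ :: _ => none
  | f + 1, ts => (skipEntry K ts).bind fun ts' => (countEntries K f ts').map (· + 1)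

/-- `entryP` skips an entry. [folklore] -/
theorem entryP_skip (K : ℕ) (ts : List Tok) : (entryP K ts).map Prod.snd = skipEntry K ts := by
  unfold entryP skipEntry skipRec
  have e : 1 + 6 * K = 1 + K * 6 := by ring
  rw [e, skipFields_add]
  simp only [skipFields, Option.bind_eq_bind, skipField_eq]
  rcases field ts with _ | ⟨uw, t₁⟩
  · rfl
  simp only [Option.map_some, Option.bind_some]
  rw [← groups_skip egP_skip K t₁]
  rcases groups egP K t₁ with _ | ⟨hs, t₂⟩
  · rfl
  simp only [Option.map_some, Option.bind_some]
  rcases t₂ with _ | ⟨_ | _ | _, t₃⟩ <;> rfl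

/-- `entriesP` counts entries. [folklore] -/
theorem entriesP_count (K : ℕ) : ∀ (f : ℕ) (ts : List Tok),
    (entriesP K f ts).map List.length = countEntries K f ts
  | f, [] => by cases f <;> rfl
  | 0, _ :: _ => rfl
  | f + 1, t :: ts => by
    simp only [entriesP, countEntries, Option.bind_eq_bind]
    rw [← entryP_skip K (t :: ts)]
    rcases entryP K (t :: ts) with _ | ⟨en, ts'⟩
    · rfl
    · simp only [Option.map_some, Option.bind_some]
      rw [← entriesP_count K f ts']
      rcases entriesP K f ts' with _ | es <;> rfl

/-- **Decodability of `y₃` is a shape property.** [folklore] -/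
theorem decY3_isSome_iff (K : ℕ) (y : List Bool) :
    decY3 K y ≠ none ↔ ∃ ts, toks y = some ts ∧ ∃ c, countEntries K ts.length ts = some c := by
  unfold decY3
  rcases htk : toks y with _ | ts
  · simp
  simp only [Option.bind_eq_bind, Option.bind_some, ne_eq, Option.some.injEq, exists_eq_left']
  have hc := entriesP_count K ts.length ts
  rcases hr : entriesP K ts.length ts with _ | es
  · rw [hr] at hc; simp only [Option.map_none] at hc; simp [← hc]
  · rw [hr] at hc; simp only [Option.map_some] at hc; simp [← hc]

/-! ### The branch index -/

/-- **Decodability of `y₂`**: all symbols `true`. [folklore] -/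
theorem decJ_isSome_iff (y : List Bool) : decJ y ≠ none ↔ y.all id = true := by
  unfold decJ; split <;> simp_all

/-- The decoded branch index is the length. [folklore] -/
theorem decJ_eq_some_iff (y : List Bool) (j : ℕ) : decJ y = some j ↔ y.all id = true ∧ y.length = j := by
  unfold decJ; split <;> simp_all

end PPSTSpec

end Literature.Computability.Complexity
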